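import Summits.ResolutionOfSingularities.ResolutionOfSingularities.Theorems.PurelyInseparableDim4LoopCLocalEscape
import Summits.ResolutionOfSingularities.ResolutionOfSingularities.Theorems.PurelyInseparableDim4LeafStepAlong
import HarnessLib

/-!
# [OURS · res-dim4-pi · F4-C] GLOBAL edge = HOP along the centre, then a LOCAL reply — the R1 dictionary
  (WORD #45) in kernel form, and LOOP-C's hop read as the local reply at the far point of the centre

Cell `res-dim4-pi` (D-0157 DOOR 2, wave 2), seat `res-dim4-p-6` g2; sequel of `…LoopCLocalEscape` (p663219:
reply-class games `LoopCLocal.RSucc q ρ` / `RWins q ρ`, the local class `localB`).  The desk's ruling R1 keeps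
the tree's `Edge` (B may answer at ANY closed point `b` of the new exceptional divisor over the centre,
`b_j = 0`) as the GLOBAL game of record and types the LOCAL game (B answers over the current point only,
`bᵢ = 0` off the centre) next to it.  This file is the exact relation between the two:

* §1 **`edge_iff_exists_hop_local`** (every field, every `q`, no hypothesis): `Edge q S s s'` holds iff for
  some point `c` of the centre (`c|_S = 0`) the state MOVED to `c`,
  `s@c = ⟨translate c F, r|_{c = 0}, exc|_{c = 0}⟩` (res-dim4-p-1's `MohAlong`: the presented state of the same
  hypersurface at the point `c` of `C_S`, components not through `c` dropped; not re-cleaned), has a LOCAL reply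
  onto `s'`: `LoopCLocal.RSucc q localB (s@c) S s'`.  A global reply is a HOP `c` along the centre followed by
  a local reply `b'` in the fibre over the new point (`b = b' + c`, p-10 g2's `LeafStep.piecewise_add_piecewise`;
  the step and the point transform agree by p-1's `MohAlong.step_add_eq_step_translate` and p-10 g2's
  `LeafStep.pointTransform_add`).  `isEquimultiplePoint_add_iff` is the equimultiplicity half alone.
* §2 **`inScopeStateWins_iff_wins_hopLocal`**: p-14's GLOBAL in-scope attractor is A's attractor of the game
  whose B-replies are (hop, local reply) pairs — the global game IS the local game restarted by B at a point
  of its choice on every centre A plays; `inScopeStateWins_move_hopLocal` (a state all of whose moved states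
  `s@c` along `C_S` have only winning local replies is won by playing `S`).
* §3 **LOOP-C read locally** (‖ K over `𝔽₃`): the separating reply of LOOP-C at `t2 = s2` — chart `x₁`, point
  `(0,0,2,1)` — is the HOP `c = (0,0,2,0)` to the far point of the centre `V(x₁,x₄)` followed by the LOCAL reply
  `b' = (0,0,0,1)` there: `t2far` presents `s2@c` (`t2far_toState`), `hop_is_local_at_far_point :
  RSucc 3 localB t2far.toState {0,3} t3.toState`; and the far point is a worse point of the same centre:
  `t2far` has a `3`-fold origin with `V(x₁,x₄)` still permissible (`t2far_permissible`), and is NOT one of the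
  six region states (`t2far_not_mem_loopC`) — in the LOCAL game LOOP-C never returns, B escapes the region
  only by changing the point.

Scope (honest): §1–§2 are statements about OUR frame (`CentreBlowup.step`, `PIDim4.Edge`) valid for every
field and `q`; §3 is `𝔽₃`-rational data at `(3,3)`.  [OURS · counted 0 · elementary + kernel certificate; AI
kernel work, weaker than expert review.]  NOTHING here is a statement about resolution of singularities;
resolution in dimension `≥ 4` / characteristic `p > 0` is NOT proved by anything in this file.
bears_on: LADDER-RESOLUTION:D157-DOOR2 (res-dim4-pi · F4-C-glob/F4-C-loc dictionary · C-LOOP-C).  Host item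
(DR-157-C): `stmt-ResolutionOfSingularities-16155`, helper.
-/

set_option linter.dupNamespace false -- mandated namespace of this single-conjunct summit

noncomputable section

open MvPolynomial Finset

namespace Summit.ResolutionOfSingularities.ResolutionOfSingularities.Theorems.PIDim4

namespace EdgeHop

open Literature.AlgebraicGeometry.Resolution
open Literature.AlgebraicGeometry.Resolution.CentreBlowup
open StepKit LoopC LoopCLocal InScopeWinCert

variable {K : Type} [Field K] [DecidableEq K]

/-! ## §1 A global reply is a hop along the centre followed by a local reply -/

/-- **Equimultiplicity at `b' + c` is equimultiplicity at the fibre point `b'` of the moved state `s@c`**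
(`c` supported off `S`; the two point transforms coincide, `LeafStep.pointTransform_add`). OURS. [folklore] -/
theorem isEquimultiplePoint_add_iff (q : ℕ) {S : Finset (Fin 4)} {j : Fin 4} (hj : j ∈ S)
    (b' c : Fin 4 → K) (hc : ∀ i ∈ S, c i = 0) (s : State K) :
    IsEquimultiplePoint q S j (b' + c) s ↔
      IsEquimultiplePoint q S j b' ⟨PointBlowup.translate c s.F, s.r.filter (fun i => c i = 0),
        s.exc.filter (fun i => c i = 0)⟩ := by
  unfold IsEquimultiplePoint
  rw [LeafStep.pointTransform_add hj b' c hc s]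

omit [DecidableEq K] in
/-- the centre part of a reply vanishes on `S`. OURS. [folklore] -/
theorem piecewise_zero_apply_of_mem (S : Finset (Fin 4)) (b : Fin 4 → K) {i : Fin 4} (hi : i ∈ S) :
    S.piecewise (0 : Fin 4 → K) b i = 0 := by
  rw [Finset.piecewise_eq_of_mem _ _ _ hi, Pi.zero_apply]

omit [DecidableEq K] in
/-- the fibre part of a reply vanishes off `S`. OURS. [folklore] -/
theorem piecewise_zero_apply_of_not_mem (S : Finset (Fin 4)) (b : Fin 4 → K) {i : Fin 4} (hi : i ∉ S) :
    S.piecewise b (0 : Fin 4 → K) i = 0 := by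
  rw [Finset.piecewise_eq_of_notMem _ _ _ hi, Pi.zero_apply]

/-- **GLOBAL EDGE = HOP + LOCAL REPLY** (every field, every `q`): `Edge q S s s'` iff for some point `c` of the
centre (`c|_S = 0`) the state moved to `c`, `s@c = ⟨translate c F, r|_{c=0}, exc|_{c=0}⟩`, has a LOCAL reply
(`b'|_{¬S} = 0`) onto `s'`.  (`→`: split `b = S.piecewise b 0 + S.piecewise 0 b`; `←`: `b := b' + c`.)
OURS (res-dim4-p-6; p-1's `MohAlong.step_add_eq_step_translate`, p-10 g2's `LeafStep.pointTransform_add`).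
[folklore] -/
theorem edge_iff_exists_hop_local (q : ℕ) (S : Finset (Fin 4)) (s s' : State K) :
    Edge q S s s' ↔ ∃ c : Fin 4 → K, (∀ i ∈ S, c i = 0) ∧
      RSucc q localB ⟨PointBlowup.translate c s.F, s.r.filter (fun i => c i = 0),
        s.exc.filter (fun i => c i = 0)⟩ S s' := by
  constructor
  · rintro ⟨j, b, hj, hbj, heq, hne, rfl⟩
    have hsplit := LeafStep.piecewise_add_piecewise S b
    have hc : ∀ i ∈ S, S.piecewise (0 : Fin 4 → K) b i = 0 := fun i hi => piecewise_zero_apply_of_mem S b hi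
    have hb' : ∀ i, i ∉ S → S.piecewise b (0 : Fin 4 → K) i = 0 :=
      fun i hi => piecewise_zero_apply_of_not_mem S b hi
    have hstep := MohAlong.step_add_eq_step_translate q hj (S.piecewise b 0) (S.piecewise 0 b) hb' hc s
    rw [hsplit] at hstep
    refine ⟨S.piecewise 0 b, hc, j, S.piecewise b 0, hj, ?_, ?_, ?_, ?_, ?_⟩
    · rw [Finset.piecewise_eq_of_mem _ _ _ hj]
      exact hbj
    · exact (localB_eq_true_iff S j _).mpr hb'
    · rw [← isEquimultiplePoint_add_iff q hj _ _ hc s, hsplit]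
      exact heq
    · rw [← hstep]
      exact hne
    · rw [← hstep]
  · rintro ⟨c, hc, j, b', hj, hb'j, hloc, heq, hne, rfl⟩
    have hb' := (localB_eq_true_iff S j b').mp hloc
    have hstep := MohAlong.step_add_eq_step_translate q hj b' c hb' hc s
    refine ⟨j, b' + c, hj, ?_, ?_, ?_, ?_⟩
    · rw [Pi.add_apply, hb'j, hc j hj, add_zero]
    · exact (isEquimultiplePoint_add_iff q hj b' c hc s).mpr heq
    · rw [hstep]
      exact hne
    · rw [hstep]

/-- In particular a LOCAL reply is a global reply with the trivial hop `c = 0`. OURS. [folklore] -/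
theorem edge_of_rSucc_local (q : ℕ) (S : Finset (Fin 4)) (s s' : State K)
    (h : RSucc q localB s S s') : Edge q S s s' := by
  obtain ⟨j, b, hj, hb, -, heq, hne, hs'⟩ := h
  exact ⟨j, b, hj, hb, heq, hne, hs'⟩

/-! ## §2 The global game is the local game restarted at a point of B's choice on every centre -/

/-- **p-14's GLOBAL in-scope attractor = A's attractor of the (hop, local reply) game.** OURS. [folklore] -/
theorem inScopeStateWins_iff_wins_hopLocal (q : ℕ) (s : State K) :
    InScopeStateWins q s ↔
      Game.Wins (fun (t : State K) (S : Finset (Fin 4)) => InCoordinateScope q t.F ∧ IsPermissibleCentre q S t.F)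
        (fun t S t' => ∃ c : Fin 4 → K, (∀ i ∈ S, c i = 0) ∧
          RSucc q localB ⟨PointBlowup.translate c t.F, t.r.filter (fun i => c i = 0),
            t.exc.filter (fun i => c i = 0)⟩ S t') s := by
  unfold InScopeStateWins
  exact ⟨fun h => wins_antitone_succ (fun x m y hy => (edge_iff_exists_hop_local q m x y).mpr hy) h,
    fun h => wins_antitone_succ (fun x m y hy => (edge_iff_exists_hop_local q m x y).mp hy) h⟩

/-- **One global move, read locally**: if `S` is permissible at `s` and every LOCAL reply from every moved
state `s@c` (`c` on the centre) leads to a globally won state, then `s` is globally won (play `S`).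
OURS. [folklore] -/
theorem inScopeStateWins_move_hopLocal {q : ℕ} {s : State K} (S : Finset (Fin 4))
    (hS : IsPermissibleCentre q S s.F)
    (h : ∀ c : Fin 4 → K, (∀ i ∈ S, c i = 0) → ∀ s',
      RSucc q localB ⟨PointBlowup.translate c s.F, s.r.filter (fun i => c i = 0),
        s.exc.filter (fun i => c i = 0)⟩ S s' → InScopeStateWins q s') :
    InScopeStateWins q s :=
  inScopeStateWins_move S hS fun s' hE => by
    obtain ⟨c, hc, hloc⟩ := (edge_iff_exists_hop_local q S s s').mp hE
    exact h c hc s' hloc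

/-! ## §3 LOOP-C read locally: the hop at `s2` is the local reply at the far point of the centre -/

/-- **`s2` moved to the far point `c = (0,0,2,0)` of its centre `V(x₁,x₄)`** — the presented state of the same
hypersurface at the closed point `x₃ = 2` of the centre (`u = 1 + x₃ ↦ x₃`; `r = 0`, `exc = {x₁, x₂}` unchanged
as `c₁ = c₂ = 0`). [OURS · data] -/
def t2far : SData 4 (ZMod 3) := ⟨transAll ![0, 0, 2, 0] t2.L, ![0, 0, 0, 0], {0, 1}⟩

/-- `t2far` presents the moved state `s2@(0,0,2,0)` of §1. [OURS · ‖ K] -/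
theorem t2far_toState :
    t2far.toState = ⟨PointBlowup.translate (![0, 0, 2, 0] : Fin 4 → ZMod 3) t2.toState.F,
      t2.toState.r.filter (fun i => (![0, 0, 2, 0] : Fin 4 → ZMod 3) i = 0),
      t2.toState.exc.filter (fun i => (![0, 0, 2, 0] : Fin 4 → ZMod 3) i = 0)⟩ := by
  simp only [SData.toState, CState.mk.injEq]
  refine ⟨(translate_evalT (![0, 0, 2, 0] : Fin 4 → ZMod 3) t2.L).symm, ?_, by decide⟩
  ext i
  rw [Finsupp.filter_apply, expo_apply, expo_apply]
  fin_cases i <;> simp [t2far, t2]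

/-- **LOOP-C's separating reply is LOCAL AT THE FAR POINT**: from `s2@(0,0,2,0)` the fibre point
`b' = (0,0,0,1)` of the `x₁`-chart (a local reply: `b'|_{¬S} = 0`) is equimultiple and lands on `t3 = s3`.
[OURS · ‖ K] -/
theorem hop_is_local_at_far_point : RSucc 3 localB t2far.toState ({0, 3} : Finset (Fin 4)) t3.toState := by
  refine ⟨0, ![0, 0, 0, 1], by decide, rfl, by decide, ?_, ?_, ?_⟩
  · exact (isEquimultiplePoint_iff 3 {0, 3} 0 _ t2far).mpr (by decide +kernel)
  · exact (step_F_ne_zero_iff 3 {0, 3} 0 _ t2far).mpr (by decide +kernel)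
  · exact ((step_eq_iff 3 {0, 3} 0 _ t2far t3).mpr (by decide +kernel)).symm

/-- The same reply assembled through §1: the global LOOP-C edge `s2 → s3` from the hop decomposition.
[OURS · ‖ K] -/
theorem edge_t2_t3_via_hop : Edge 3 ({0, 3} : Finset (Fin 4)) t2.toState t3.toState :=
  (edge_iff_exists_hop_local 3 {0, 3} t2.toState t3.toState).mpr
    ⟨![0, 0, 2, 0], by decide, t2far_toState ▸ hop_is_local_at_far_point⟩

/-- **The far point is a worse point of the same centre**: `s2@(0,0,2,0)` has a `3`-fold origin and
`V(x₁,x₄)` is still permissible there (the centre passes through it). [OURS · ‖ K] -/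
theorem t2far_permissible :
    IsPermissibleCentre 3 Finset.univ t2far.toState.F ∧
      IsPermissibleCentre 3 ({0, 3} : Finset (Fin 4)) t2far.toState.F :=
  ⟨(isPermissibleCentre_iff 3 Finset.univ t2far.L).mpr (by decide +kernel),
    (isPermissibleCentre_iff 3 {0, 3} t2far.L).mpr (by decide +kernel)⟩

/-- **… and it is none of the six region states**: read LOCALLY, LOOP-C leaves its region at the hop and never
comes back to `s2`'s point. [OURS · ‖ K] -/
theorem t2far_not_mem_loopC : t2far.toState ∉ trapSet loopC := by
  rintro ⟨sw, hsw, heq⟩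
  simp only [loopC, List.mem_cons, List.not_mem_nil, or_false] at hsw
  rcases hsw with rfl | rfl | rfl | rfl | rfl | rfl <;>
    exact absurd ((toState_eq_iff _ t2far).mp heq) (by decide +kernel)

end EdgeHop

end Summit.ResolutionOfSingularities.ResolutionOfSingularities.Theorems.PIDim4

end
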